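import Literature.NumberTheory.Automorphic.RegularAlgebraicCuspidalHeckePointProofs
import Literature.NumberTheory.Automorphic.ArithmeticQuotientTransfer
import Literature.NumberTheory.Automorphic.HeckeTowerCompatibility
import Summits.Langlands.Langlands.Theses.ParityBlindBianchi
import HarnessLib

/-!
# `TwoAdicBianchiProModularityLevel` (crux stmt-Langlands-15110, route `ParityBlindBianchi`) —
# ODD-INDEX LEVEL CHANGE: points of `Spf 𝕋` persist to every sub-tower of invertible index

Generic vocabulary of `CompletedCohomology` (`Γ → 𝒢`, towers `T`, `T'`, Hecke elements `δ : J → 𝒢`,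
coefficients `k`, `ϖ`).  Let `T'` be a SUB-TOWER of `T` (`K'(s) ≤ K(s)` for all `s`) such that the
Hecke operators `T_{δ j}` commute with the pull-backs `res_s : H^i(X_{K(s)}, k/ϖ^t) → H^i(X_{K'(s)}, k/ϖ^t)`
(true when `K'(s) δ_j K'(s)/K'(s) → K(s) δ_j K(s)/K(s)` is a bijection: levels differing away from the
support of `δ_j`, `HeckeTowerCompatibility`).  By restriction–transfer (`ArithmeticQuotientTransfer`:
`tr ∘ res = [K(s) : K'(s)]`, so `ker res_s` is killed by the index), a non-commutative polynomial `P`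
in the `T_{δ j}` that vanishes on finitely many pieces of `T'` has `[K(s):K'(s)] · P` vanishing on the
corresponding pieces of `T`.  Hence (`isHeckePoint_iff_forall_freeAlgebra`):

* `IsHeckePoint.of_subtower` — **if the indices `[K(s) : K'(s)]` are units of `k`, every `k`-point
  of `Spf 𝕋` of the tower `T` is a point of `Spf 𝕋` of the sub-tower `T'`** (same Hecke elements,
  same values).  For `k = ℤ̄₂`: points persist to any sub-tower of ODD index — the torsion shadow of
  "old forms persist to smaller level", in the half that needs no Hochschild–Serre (even index would).
* `IsHeckePoint.of_subtower_of_bijOn` — the same with the commutation hypothesis replaced by the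
  double-coset bijection criterion of `HeckeTowerCompatibility`.
* `crux_isHeckePoint_of_subtower` (registered sub-goal) — the crux's literal setting
  (`Γ = GL₂(K) → GL₂(𝔸_K^∞)`, towers `U ∩ K((2)^r)` and `U' ∩ K((2)^r)` for `U' ≤ U`, Hecke family
  `(v,i) ↦ (t_{v,i+1})_f` over the good places, `k = ℤ̄₂`, `ϖ = 2`): if `[U ∩ K((2)^r) : U' ∩ K((2)^r)]`
  is odd for every `r` and the good Hecke double cosets correspond, Hecke data `a` that are a point at
  tame level `U` are a point at tame level `U'`.  Bearing on stub B (`stub_artinLift`, conclusion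
  `∃ U …`): the tame level in B's conclusion may be shrunk for free along odd-index steps — e.g. from the
  first principal congruence level `K_λ(λ)` at an odd place `λ ∈ S₀` to any deeper `K_λ(λ^m)` (pro-`ℓ`
  index) — so "U as deep as needed at the odd places of S₀" costs nothing beyond depth one; the
  even-index steps (`GL₂(𝒪_λ) ⊋ K_λ(λ)`) are where `2`-adic level-lowering/raising content lives.

Sorry-free, definition-free; lead c9 (line `Sketch`, cycle 10).
-/

noncomputable section

set_option linter.dupNamespace false

namespace Summit.Langlands.Langlands.Theorems.TwoAdicBianchiProModularityLevel

open CategoryTheory Literature.NumberTheory.Automorphic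

universe v w w'

/-! ### Generic: intertwining non-commutative polynomials of operators -/

section Intertwine

variable {k : Type} [CommRing k] {J : Type v}
  {H : Type w} [AddCommGroup H] [Module k H] {H' : Type w'} [AddCommGroup H'] [Module k H']

/-- A linear map intertwining two families of operators value by value intertwines every
non-commutative polynomial in them. [folklore] -/
theorem comp_lift_eq_lift_comp (S : J → Module.End k H) (S' : J → Module.End k H') (r : H →ₗ[k] H')
    (hr : ∀ j, r ∘ₗ S j = S' j ∘ₗ r) (P : FreeAlgebra k J) :
    r ∘ₗ FreeAlgebra.lift k S P = FreeAlgebra.lift k S' P ∘ₗ r := by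
  induction P using FreeAlgebra.induction with
  | grade0 c =>
    rw [AlgHom.commutes, AlgHom.commutes, Module.algebraMap_end_eq_smul_id,
      Module.algebraMap_end_eq_smul_id, LinearMap.comp_smul, LinearMap.smul_comp,
      LinearMap.comp_id, LinearMap.id_comp]
  | grade1 j => rw [FreeAlgebra.lift_ι_apply, FreeAlgebra.lift_ι_apply, hr j]
  | mul a b ha hb =>
    rw [map_mul, map_mul, Module.End.mul_eq_comp, Module.End.mul_eq_comp, ← LinearMap.comp_assoc,
      ha, LinearMap.comp_assoc, hb, LinearMap.comp_assoc]
  | add a b ha hb => rw [map_add, map_add, LinearMap.comp_add, LinearMap.add_comp, ha, hb]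

end Intertwine

/-! ### Generic: points of `Spf 𝕋(T)` are points of `Spf 𝕋(T')` for sub-towers of invertible index -/

section Generic

variable {k : Type} [CommRing k] {Γ 𝒢 : Type} [Group Γ] [Group 𝒢]
  {ι : Γ →* 𝒢} {T T' : LevelTower 𝒢} {ϖ : k} {J : Type v} {δ : J → 𝒢} {χ : J → k}

variable (ι ϖ δ) in
/-- The `z`-component of the diagonal action of an abstract Hecke operator is its action on the
piece `z`. [folklore] -/
theorem lift_towerHeckeFamily_apply (T : LevelTower 𝒢) (P : FreeAlgebra k J) (z : TowerIndex) :
    FreeAlgebra.lift k (fun j => towerHeckeFamily k ι T ϖ (δ j)) P z =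
      FreeAlgebra.lift k (fun j => towerHeckeFamily k ι T ϖ (δ j) z) P := by
  have hcomp : (FreeAlgebra.lift k fun j => towerHeckeFamily k ι T ϖ (δ j) z) =
      (Pi.evalAlgHom k (fun x : TowerIndex => Module.End k (towerCohomology k ι T ϖ x.1 x.2.1 x.2.2))
        z).comp (FreeAlgebra.lift k fun j => towerHeckeFamily k ι T ϖ (δ j)) := by
    refine FreeAlgebra.hom_ext (funext fun j => ?_)
    simp only [Function.comp_apply, AlgHom.comp_apply, FreeAlgebra.lift_ι_apply]
    rfl
  rw [hcomp]
  rfl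

/-- **Points persist to sub-towers of invertible index.**  Let `T'` be a sub-tower of `T`
(`K'(s) ≤ K(s)`), suppose every `T_{δ j}` commutes with the pull-backs
`H^i(X_{K(s)}, k/ϖ^t) → H^i(X_{K'(s)}, k/ϖ^t)` (pieces indexed by `z = (i, s, t) : TowerIndex`), and that
the indices `[K(s) : K'(s)]` are units in `k`.  Then every point `χ` of `Spf 𝕋` of `T` is a point of
`Spf 𝕋` of `T'`: if `P` kills the pieces `z ∈ I` of `T'`, then `res ∘ P_T = P_{T'} ∘ res = 0` on the
corresponding pieces of `T`, so `[K(s):K'(s)] · P_T = tr ∘ res ∘ P_T = 0` there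
(`relIndex_smul_eq_zero_of_cohomologyPullback_eq_zero`), whence `(∏_{I} [K(s):K'(s)]) · P(χ) ∈ (ϖ^t)`
and `P(χ) ∈ (ϖ^t)`. [cite: Brown1982CohomologyGroups, Ch. III, Prop. 9.5 (ii), Prop. 10.1] -/
theorem IsHeckePoint.of_subtower (hle : ∀ s, T'.level s ≤ T.level s)
    (hcomm : ∀ (j : J) (z : TowerIndex),
      (ArithmeticQuotient.cohomologyPullback k ι (modPow k ϖ z.2.2) (hle z.2.1) z.1).hom ∘ₗ
          towerHeckeFamily k ι T ϖ (δ j) z =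
        towerHeckeFamily k ι T' ϖ (δ j) z ∘ₗ
          (ArithmeticQuotient.cohomologyPullback k ι (modPow k ϖ z.2.2) (hle z.2.1) z.1).hom)
    (hunit : ∀ s, IsUnit (((T'.level s).relIndex (T.level s) : ℕ) : k))
    (h : IsHeckePoint ι T ϖ δ χ) : IsHeckePoint ι T' ϖ δ χ := by
  classical
  rw [isHeckePoint_iff_forall_freeAlgebra] at h ⊢
  intro t
  obtain ⟨I, hI⟩ := h t
  refine ⟨I, fun P hP => ?_⟩
  -- a common multiple `N` of the indices of the levels met by `I`, a unit in `k`
  obtain ⟨N, hNdvd, hNu⟩ : ∃ N : ℕ, (∀ z ∈ I, (T'.level z.2.1).relIndex (T.level z.2.1) ∣ N) ∧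
      IsUnit ((N : ℕ) : k) := by
    refine ⟨∏ z ∈ I, (T'.level z.2.1).relIndex (T.level z.2.1),
      fun z hz => Finset.dvd_prod_of_mem (fun z : TowerIndex => (T'.level z.2.1).relIndex (T.level z.2.1)) hz,
      ?_⟩
    rw [Nat.cast_prod]
    exact IsUnit.prod_iff.mpr fun z _ => hunit z.2.1
  -- `(N • P)_T` kills the pieces of `I`
  have hkill : ∀ z ∈ I,
      FreeAlgebra.lift k (fun j => towerHeckeFamily k ι T ϖ (δ j)) (((N : ℕ) : k) • P) z = 0 := by
    intro z hz
    rw [map_smul, Pi.smul_apply, lift_towerHeckeFamily_apply]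
    refine LinearMap.ext fun x => ?_
    rw [LinearMap.smul_apply, LinearMap.zero_apply]
    -- `res (P_T x) = P_{T'} (res x) = 0`
    have hres : (ArithmeticQuotient.cohomologyPullback k ι (modPow k ϖ z.2.2) (hle z.2.1) z.1).hom
        (FreeAlgebra.lift k (fun j => towerHeckeFamily k ι T ϖ (δ j) z) P x) = 0 := by
      have hc := LinearMap.congr_fun (comp_lift_eq_lift_comp
        (fun j => towerHeckeFamily k ι T ϖ (δ j) z) (fun j => towerHeckeFamily k ι T' ϖ (δ j) z)
        (ArithmeticQuotient.cohomologyPullback k ι (modPow k ϖ z.2.2) (hle z.2.1) z.1).hom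
        (fun j => hcomm j z) P) x
      have hP' : FreeAlgebra.lift k (fun j => towerHeckeFamily k ι T' ϖ (δ j) z) P = 0 := by
        rw [← lift_towerHeckeFamily_apply ι ϖ δ T', hP z hz]
      rw [LinearMap.comp_apply, LinearMap.comp_apply, hP', LinearMap.zero_apply] at hc
      exact hc
    have h1 := ArithmeticQuotient.relIndex_smul_eq_zero_of_cohomologyPullback_eq_zero k
      (T.level z.2.1) (T'.level z.2.1) (modPow k ϖ z.2.2) ι (hle z.2.1) z.1 hres
    obtain ⟨m, hm⟩ := hNdvd z hz
    rw [Nat.cast_smul_eq_nsmul, hm, mul_nsmul, h1, smul_zero]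
  have hval := hI _ hkill
  rw [map_smul, smul_eq_mul] at hval
  obtain ⟨u, hu⟩ := hNu
  have hPu : FreeAlgebra.lift k χ P = (↑u⁻¹ : k) * (((N : ℕ) : k) * FreeAlgebra.lift k χ P) := by
    rw [← hu, ← mul_assoc, Units.inv_mul, one_mul]
  rw [hPu]
  exact Ideal.mul_mem_left _ _ hval

/-- **Points persist to sub-towers of invertible index** — double-coset form of the commutation
hypothesis: it suffices that `K'(s) δ_j K'(s) / K'(s) → K(s) δ_j K(s) / K(s)` is a bijection onto a
finite set for all `s`, `j` (`heckeOperator_comp_cohomologyPullback`). [cite: Brown1982CohomologyGroups,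
Ch. III, Prop. 9.5 (ii), Prop. 10.1] -/
theorem IsHeckePoint.of_subtower_of_bijOn (hle : ∀ s, T'.level s ≤ T.level s)
    (hbij : ∀ (s : ℕ) (j : J), Set.BijOn (Subgroup.quotientMapOfLE (hle s))
      (ArithmeticQuotient.doubleCosetQuot (T'.level s) (δ j))
      (ArithmeticQuotient.doubleCosetQuot (T.level s) (δ j)))
    (hfin : ∀ (s : ℕ) (j : J), (ArithmeticQuotient.doubleCosetQuot (T.level s) (δ j)).Finite)
    (hunit : ∀ s, IsUnit (((T'.level s).relIndex (T.level s) : ℕ) : k))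
    (h : IsHeckePoint ι T ϖ δ χ) : IsHeckePoint ι T' ϖ δ χ := by
  refine IsHeckePoint.of_subtower hle (fun j z => ?_) hunit h
  have hc := ArithmeticQuotient.heckeOperator_comp_cohomologyPullback k ι (modPow k ϖ z.2.2)
    (hle z.2.1) (δ j) (hbij z.2.1 j) (hfin z.2.1 j) z.1
  have hc' := congrArg ModuleCat.Hom.hom hc
  rw [ModuleCat.hom_comp, ModuleCat.hom_comp] at hc'
  exact hc'

end Generic

/-! ### The crux's setting: `k = ℤ̄₂`, odd indices -/

section Crux

open scoped NumberField
open IsDedekindDomain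

/-- Sub-towers from smaller tame levels: `U' ≤ U` gives `U' ∩ K(s) ≤ U ∩ K(s)` levelwise for the towers
`LevelTower.ofSeq` built on the same sequence (for the crux: `K(s) = K((2)^s)`). [folklore] -/
theorem ofSeq_level_mono {𝒢 : Type} [Group 𝒢] {U U' : Subgroup 𝒢} (h : U' ≤ U)
    (Ks : ℕ → Subgroup 𝒢) (s : ℕ) :
    (LevelTower.ofSeq U' Ks).level s ≤ (LevelTower.ofSeq U Ks).level s :=
  inf_le_inf_right _ h

/-- Odd natural numbers are units of `ℤ̄₂` (the valuation ring of `ℚ̄₂`). [folklore] -/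
theorem isUnit_natCast_valuationSubring_two_of_odd {n : ℕ} (hn : Odd n) :
    IsUnit ((n : ℕ) : (PadicAlgCl.valued 2).v.valuationSubring) := by
  have hnorm : ‖(n : PadicAlgCl 2)‖ = 1 := by
    rw [← map_natCast (algebraMap ℚ_[2] (PadicAlgCl 2)) n]
    change ‖((n : ℚ_[2]) : PadicAlgCl 2)‖ = 1
    rw [PadicAlgCl.norm_extends, Padic.norm_natCast_eq_one_iff]
    exact Nat.coprime_two_left.mpr hn
  have hn0 : (n : PadicAlgCl 2) ≠ 0 := norm_ne_zero_iff.mp (by rw [hnorm]; exact one_ne_zero)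
  have hv : ∀ z : PadicAlgCl 2, Valued.v z ≤ 1 ↔ ‖z‖ ≤ 1 := fun z => by
    rw [PadicAlgCl.valuation_def, ← NNReal.coe_le_coe, coe_nnnorm, NNReal.coe_one]
  have hinv : (n : PadicAlgCl 2)⁻¹ ∈ (PadicAlgCl.valued 2).v.valuationSubring :=
    (Valuation.mem_valuationSubring_iff _ _).mpr ((hv _).mpr (by rw [norm_inv, hnorm, inv_one]))
  refine IsUnit.of_mul_eq_one ⟨(n : PadicAlgCl 2)⁻¹, hinv⟩ (Subtype.ext ?_)
  push_cast
  exact mul_inv_cancel₀ hn0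

/-- **Odd-index level change, in the crux's vocabulary** (registered sub-goal).  For
`Γ = GL₂(K) → 𝒢 = GL₂(𝔸_K^∞)` diagonally, two towers `T' ≤ T` of `𝒢` (for the crux and stub B:
`T = (U ∩ K((2)^s))_s`, `T' = (U' ∩ K((2)^s))_s` with `U' ≤ U`, `ofSeq_level_mono`), the Hecke family
`(v, i) ↦ (t_{v,i+1})_f` over a type `S` of (good) places whose double cosets at the levels of `T'` and
`T` correspond bijectively (levels differing only at bad places) and are finite (compact open levels),
coefficients `ℤ̄₂`, `ϖ = 2`: if every index `[K(s) : K'(s)]` is ODD, then Hecke data `a` forming a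
point of `Spf 𝕋` of `T` form a point of `Spf 𝕋` of `T'`.  So in the conclusion of B / of the crux the
tame level may be shrunk along odd-index steps at no cost (e.g. deeper into the pro-`ℓ` tower at an
odd place `λ ∈ S₀` once past `K_λ(λ)`). [cite: Brown1982CohomologyGroups, Ch. III, Prop. 9.5 (ii),
Prop. 10.1] -/
theorem crux_isHeckePoint_of_subtower : ∀ (K : Type) [Field K] [NumberField K]
    (T T' : LevelTower (GL (Fin 2) (FiniteAdeleRing (𝓞 K) K))) (hle : ∀ s : ℕ, T'.level s ≤ T.level s)
    (S : Type) (pl : S → HeightOneSpectrum (𝓞 K))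
    (ϖ : ∀ v : HeightOneSpectrum (𝓞 K), (v.adicCompletion K)ˣ)
    (a : S → ℕ → (PadicAlgCl.valued 2).v.valuationSubring),
    (∀ (s : ℕ) (j : S × Fin 2), Set.BijOn (Subgroup.quotientMapOfLE (hle s))
      (ArithmeticQuotient.doubleCosetQuot (T'.level s)
        (GLn.sndHom 2 K (heckeDiagAt 2 K (pl j.1) (ϖ (pl j.1)) (j.2.val + 1))))
      (ArithmeticQuotient.doubleCosetQuot (T.level s)
        (GLn.sndHom 2 K (heckeDiagAt 2 K (pl j.1) (ϖ (pl j.1)) (j.2.val + 1))))) →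
    (∀ (s : ℕ) (j : S × Fin 2), (ArithmeticQuotient.doubleCosetQuot (T.level s)
      (GLn.sndHom 2 K (heckeDiagAt 2 K (pl j.1) (ϖ (pl j.1)) (j.2.val + 1)))).Finite) →
    (∀ s : ℕ, Odd ((T'.level s).relIndex (T.level s))) →
    IsHeckePoint
      (Matrix.GeneralLinearGroup.map (algebraMap K (FiniteAdeleRing (𝓞 K) K)) :
        GL (Fin 2) K →* GL (Fin 2) (FiniteAdeleRing (𝓞 K) K))
      T ((2 : ℕ) : (PadicAlgCl.valued 2).v.valuationSubring)
      (fun j : S × Fin 2 => GLn.sndHom 2 K (heckeDiagAt 2 K (pl j.1) (ϖ (pl j.1)) (j.2.val + 1)))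
      (fun j => a j.1 (j.2.val + 1)) →
    IsHeckePoint
      (Matrix.GeneralLinearGroup.map (algebraMap K (FiniteAdeleRing (𝓞 K) K)) :
        GL (Fin 2) K →* GL (Fin 2) (FiniteAdeleRing (𝓞 K) K))
      T' ((2 : ℕ) : (PadicAlgCl.valued 2).v.valuationSubring)
      (fun j : S × Fin 2 => GLn.sndHom 2 K (heckeDiagAt 2 K (pl j.1) (ϖ (pl j.1)) (j.2.val + 1)))
      (fun j => a j.1 (j.2.val + 1)) := by
  intro K _ _ T T' hle S pl ϖ a hbij hfin hodd hpt
  exact IsHeckePoint.of_subtower_of_bijOn hle hbij hfin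
    (fun s => isUnit_natCast_valuationSubring_two_of_odd (hodd s)) hpt

end Crux


end Summit.Langlands.Langlands.Theorems.TwoAdicBianchiProModularityLevel

end
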